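import Summits.NavierStokesRegularity.NavierStokesRegularity.Theorems.PerpetualPumpThesisBesovDuhamelBoundNonlinear
import Mathlib.Analysis.SpecialFunctions.Integrals.Basic

/-!
# Stub `besovDuhamelBound` for `PerpetualPump.Thesis`: the Besov–Duhamel a-priori bound in
# `Ḃ⁰_{∞,1}` along `H¹⁰_df`-mild solutions of an averaged Navier–Stokes equation

Final file of the stub `besovDuhamelBound` of line `SketchIdeator2` (crux
stmt-NavierStokesRegularity-1832), proving the registered statement `stub_besovDuhamelBound`: for every
averaging datum `𝒜` (T. Tao, J. Amer. Math. Soc. 29 (2016), (1.12)–(1.15); no symmetry or cancellation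
needed) there is `C ≥ 1` such that every mild `H¹⁰_df` solution `u` of `∂ₜu = Δu + B̃(u,u)` on `[0,T)`
obeys, for `0 ≤ t₁ ≤ t < T` and `‖u(s)‖_{Ḃ⁰_{∞,1}} ≤ M` on `[t₁,t]`,

  `‖u(t)‖_{Ḃ⁰_{∞,1}} ≤ C ‖u(t₁)‖_{Ḃ⁰_{∞,1}} + C √(t-t₁) M²`.

Mechanism (parts I–X): `u(t) = e^{(t-t₁)Δ}u(t₁) + D` with the heat propagator bounded on
`Ḃ⁰_{∞,1}` (part Bridge; BCD Lemma 2.4) and the Duhamel term `D` estimated block by block,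
`‖Δ̇_k D‖_{L^∞} ≤ 3 ∫_{t₁}^{t} K M² 2ᵏ e^{-(π²/8)(t-s)4ᵏ} ds` (part X: the blocks are pairings with the
divergence-free test fields `P Δ̇_k δ_x e_i`, the restarted Duhamel identity, the Euler form in physical
space `|⟨B(F,G),H⟩| ≤ ‖F‖_∞‖G‖_∞∑‖∂_jH_l‖_{L¹}`, slots `Ḃ⁰_{∞,1} → L^∞`, the `L¹` kernels
`≲ 2ᵏe^{-cσ4ᵏ}` of `∇ A₃ e^{σΔ} P Δ̇_k δ_x`, Tao's moment bounds); finally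
`∑_k 2ᵏ e^{-c(t-s)4ᵏ} ≤ K_d (t-s)^{-1/2}` (tree `exists_tsum_rpow_mul_exp_neg_le`) and
`∫_{t₁}^{t} (t-s)^{-1/2} ds = 2√(t-t₁)` — no `(t-t₁)⁰` term appears, the constant is `T`-independent.

## References

* T. Tao, J. Amer. Math. Soc. 29 (2016), 601–674, §1.1 (1.12)–(1.15).
* H. Bahouri, J.-Y. Chemin, R. Danchin, *Fourier Analysis and Nonlinear PDE* (2011), §2.2–2.6,
  Lemmas 2.1, 2.2, 2.4.
-/

noncomputable section

open MeasureTheory Filter Topology FourierTransform Real Set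
open scoped SchwartzMap ENNReal NNReal RealInnerProductSpace FourierTransform

set_option linter.dupNamespace false

namespace Summit.NavierStokesRegularity.NavierStokesRegularity.Theorems.PerpetualPumpThesis.FA

open Literature.Analysis.FunctionSpaces Literature.Analysis.FluidPDE
  Literature.Analysis.FluidPDE.Tao2016

/-! ### The time integral `∫_{t₁}^{t} (t-s)^{-1/2} ds = 2√(t-t₁)` -/

/-- `∫_{t₁}^{t} (t-s)^{-1/2} ds = 2 √(t - t₁)` as a lower Lebesgue integral over `(t₁, t)`. -/
theorem lintegral_Ioo_rpow_neg_half {t₁ t : ℝ} (h : t₁ ≤ t) :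
    ∫⁻ s in Ioo t₁ t, ENNReal.ofReal ((t - s) ^ (-(1 / 2 : ℝ))) = ENNReal.ofReal (2 * Real.sqrt (t - t₁)) := by
  rcases h.eq_or_lt with rfl | hlt
  · simp
  have hr : (-1 : ℝ) < -(1 / 2 : ℝ) := by norm_num
  have hint : IntervalIntegrable (fun s : ℝ => (t - s) ^ (-(1 / 2 : ℝ))) volume t₁ t := by
    have h0 := (intervalIntegral.intervalIntegrable_rpow' (a := t - t₁) (b := 0) hr).comp_sub_left t
    simpa only [sub_sub_cancel, sub_zero] using h0
  have hon : IntegrableOn (fun s : ℝ => (t - s) ^ (-(1 / 2 : ℝ))) (Ioo t₁ t) :=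
    hint.1.mono_set Ioo_subset_Ioc_self
  have hnn : 0 ≤ᵐ[volume.restrict (Ioo t₁ t)] fun s : ℝ => (t - s) ^ (-(1 / 2 : ℝ)) := by
    refine (ae_restrict_mem measurableSet_Ioo).mono fun s hs => ?_
    exact Real.rpow_nonneg (sub_nonneg.2 hs.2.le) _
  rw [← ofReal_integral_eq_lintegral_ofReal hon hnn, ← integral_Ioc_eq_integral_Ioo,
    ← intervalIntegral.integral_of_le h,
    intervalIntegral.integral_comp_sub_left (fun x : ℝ => x ^ (-(1 / 2 : ℝ))) t, sub_self,
    integral_rpow (Or.inl hr)]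
  congr 1
  rw [Real.sqrt_eq_rpow, Real.zero_rpow (by norm_num)]
  norm_num
  ring

/-! ### The dyadic–parabolic sum -/

/-- `2ᵏ e^{-κτ4ᵏ} = τ^{-1/2} · (4ᵏτ)^{1/2} e^{-κ 4ᵏτ}` for `τ > 0`. -/
theorem two_zpow_mul_exp_eq {τ : ℝ} (hτ : 0 < τ) (κ : ℝ) (k : ℤ) :
    (2 : ℝ) ^ k * Real.exp (-κ * (τ * ((2 : ℝ) ^ k) ^ 2)) =
      τ ^ (-(1 / 2 : ℝ)) * (((4 : ℝ) ^ k * τ) ^ (1 / 2 : ℝ) * Real.exp (-κ * ((4 : ℝ) ^ k * τ))) := by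
  have h4 : (4 : ℝ) ^ k = ((2 : ℝ) ^ k) ^ 2 := by
    rw [← two_zpow_two_mul_eq_four_zpow, two_zpow_two_mul]
  have h2k : 0 ≤ (2 : ℝ) ^ k := zpow_nonneg zero_le_two _
  have hsq : (((4 : ℝ) ^ k * τ)) ^ (1 / 2 : ℝ) = (2 : ℝ) ^ k * Real.sqrt τ := by
    rw [← Real.sqrt_eq_rpow, h4, Real.sqrt_mul (sq_nonneg _), Real.sqrt_sq h2k]
  have hneg : τ ^ (-(1 / 2 : ℝ)) = (Real.sqrt τ)⁻¹ := by
    rw [Real.rpow_neg hτ.le, ← Real.sqrt_eq_rpow]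
  have hsτ : Real.sqrt τ ≠ 0 := (Real.sqrt_pos.2 hτ).ne'
  rw [hsq, hneg, h4, show -κ * (((2 : ℝ) ^ k) ^ 2 * τ) = -κ * (τ * ((2 : ℝ) ^ k) ^ 2) by ring]
  field_simp

/-- **The dyadic–parabolic sum, integrated in time**: there is `K_d < ∞` with
`∑_k ∫_{t₁}^{t} 2ᵏ e^{-(π²/8)(t-s)4ᵏ} ds ≤ K_d √(t - t₁)` (`∑_k 2ᵏe^{-c(t-s)4ᵏ} ≤ K (t-s)^{-1/2}` and
`∫_{t₁}^{t} (t-s)^{-1/2} ds = 2√(t-t₁)`). -/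
theorem exists_dyadic_time_bound :
    ∃ Kd : ℝ≥0∞, Kd ≠ ⊤ ∧ ∀ (t₁ t : ℝ), t₁ ≤ t →
      ∑' k : ℤ, ∫⁻ s in Ioo t₁ t,
        ENNReal.ofReal ((2 : ℝ) ^ k * Real.exp (-(π ^ 2 / 8) * ((t - s) * ((2 : ℝ) ^ k) ^ 2))) ≤
        Kd * ENNReal.ofReal (Real.sqrt (t - t₁)) := by
  obtain ⟨K, hK, hKb⟩ := exists_tsum_rpow_mul_exp_neg_le (a := 1 / 2) (κ := π ^ 2 / 8)
    (by norm_num) (by positivity)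
  refine ⟨K * 2, ENNReal.mul_ne_top hK (by norm_num), fun t₁ t ht => ?_⟩
  have hmeas : ∀ k : ℤ, AEMeasurable (fun s : ℝ =>
      ENNReal.ofReal ((2 : ℝ) ^ k * Real.exp (-(π ^ 2 / 8) * ((t - s) * ((2 : ℝ) ^ k) ^ 2))))
      (volume.restrict (Ioo t₁ t)) := fun k =>
    (ENNReal.measurable_ofReal.comp (by fun_prop)).aemeasurable
  rw [← lintegral_tsum hmeas]
  calc ∫⁻ s in Ioo t₁ t, ∑' k : ℤ,
        ENNReal.ofReal ((2 : ℝ) ^ k * Real.exp (-(π ^ 2 / 8) * ((t - s) * ((2 : ℝ) ^ k) ^ 2)))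
      ≤ ∫⁻ s in Ioo t₁ t, ENNReal.ofReal ((t - s) ^ (-(1 / 2 : ℝ))) * K := by
        refine setLIntegral_mono' measurableSet_Ioo fun s hs => ?_
        have hτ : 0 < t - s := sub_pos.2 hs.2
        have hpt : ∀ k : ℤ, ENNReal.ofReal ((2 : ℝ) ^ k * Real.exp (-(π ^ 2 / 8) * ((t - s) * ((2 : ℝ) ^ k) ^ 2))) =
            ENNReal.ofReal ((t - s) ^ (-(1 / 2 : ℝ))) *
              ENNReal.ofReal ((((4 : ℝ) ^ k * (t - s)) ^ (1 / 2 : ℝ) *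
                Real.exp (-(π ^ 2 / 8) * ((4 : ℝ) ^ k * (t - s))))) := by
          intro k
          rw [two_zpow_mul_exp_eq hτ, ENNReal.ofReal_mul (Real.rpow_nonneg hτ.le _)]
        simp_rw [hpt]
        rw [ENNReal.tsum_mul_left]
        exact mul_le_mul' le_rfl (hKb (t - s) hτ)
    _ = K * ENNReal.ofReal (2 * Real.sqrt (t - t₁)) := by
        rw [lintegral_mul_const' _ _ hK, lintegral_Ioo_rpow_neg_half ht, mul_comm]
    _ = K * 2 * ENNReal.ofReal (Real.sqrt (t - t₁)) := by
        rw [ENNReal.ofReal_mul zero_le_two, ENNReal.ofReal_ofNat, mul_assoc]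

/-! ### The Duhamel term in `Ḃ⁰_{∞,1}` -/

/-- **The Duhamel term of a mild solution in `Ḃ⁰_{∞,1}`**:
`‖u(t) - e^{(t-t₁)Δ}u(t₁)‖_{Ḃ⁰_{∞,1}} ≤ 3 K K_d M² √(t-t₁)` under the hypotheses of
`FA.eLpNormDistrib_lpBlock_duhamel_le` (sum the blockwise bounds, then the dyadic–parabolic sum). -/
theorem eHomBesovNorm_duhamel_le (𝒜 : AveragingDatum) {K : ℝ≥0∞} (hKfin : K ≠ ⊤)
    (hK : ∀ (f : L2C), MemH10df f → ∀ (Mf : ℝ≥0∞),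
      eHomBesovNorm 0 ∞ 1 ((f : L2C) : 𝓢'(EuclideanSpace ℝ (Fin 3), EuclideanSpace ℂ (Fin 3))) ≤ Mf →
      ∀ (σ : ℝ), 0 ≤ σ → ∀ (k : ℤ) (x : EuclideanSpace ℝ (Fin 3)) (i : Fin 3) (w : L2C),
      (fourierFn w =ᵐ[volume] fun η : EuclideanSpace ℝ (Fin 3) =>
        ((𝐞 (-⟪x, η⟫) : ℂ) * dyadicSymbol k η) •
          (EuclideanSpace.single i (1 : ℂ) -
            (EuclideanSpace.complexify η i / ((‖η‖ ^ 2 : ℝ) : ℂ)) • EuclideanSpace.complexify η)) →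
      ‖𝒜.form f f (heat σ w)‖ₑ ≤
        K * Mf ^ 2 * ENNReal.ofReal ((2 : ℝ) ^ k * Real.exp (-(π ^ 2 / 8) * (σ * ((2 : ℝ) ^ k) ^ 2))))
    {Kd : ℝ≥0∞}
    (hKd : ∀ (t₁ t : ℝ), t₁ ≤ t →
      ∑' k : ℤ, ∫⁻ s in Ioo t₁ t,
        ENNReal.ofReal ((2 : ℝ) ^ k * Real.exp (-(π ^ 2 / 8) * ((t - s) * ((2 : ℝ) ^ k) ^ 2))) ≤
        Kd * ENNReal.ofReal (Real.sqrt (t - t₁)))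
    {a : L2C} {T : ℝ} {u : ℝ → L2C} (hu : IsMildSolutionFor 𝒜.form a (Ico 0 T) u)
    {t₁ t M : ℝ} (ht₁ : 0 ≤ t₁) (ht₁t : t₁ ≤ t) (htT : t < T) (hM : 0 ≤ M)
    (hB : ∀ s ∈ Icc t₁ t, eHomBesovNorm 0 ∞ 1 ((u s : L2C) :
      𝓢'(EuclideanSpace ℝ (Fin 3), EuclideanSpace ℂ (Fin 3))) ≤ ENNReal.ofReal M) :
    eHomBesovNorm 0 ∞ 1 ((u t - heat (t - t₁) (u t₁) : L2C) :
        𝓢'(EuclideanSpace ℝ (Fin 3), EuclideanSpace ℂ (Fin 3))) ≤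
      3 * K * Kd * ENNReal.ofReal (M ^ 2 * Real.sqrt (t - t₁)) := by
  have hcfin : K * ENNReal.ofReal M ^ 2 ≠ ⊤ :=
    ENNReal.mul_ne_top hKfin (ENNReal.pow_ne_top ENNReal.ofReal_ne_top)
  rw [eHomBesovNorm_zero_one_eq_tsum]
  calc ∑' k : ℤ, eLpNormDistrib ∞ (lpBlock k ((u t - heat (t - t₁) (u t₁) : L2C) :
        𝓢'(EuclideanSpace ℝ (Fin 3), EuclideanSpace ℂ (Fin 3))))
      ≤ ∑' k : ℤ, 3 * ∫⁻ s in Ioo t₁ t, K * ENNReal.ofReal M ^ 2 *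
          ENNReal.ofReal ((2 : ℝ) ^ k * Real.exp (-(π ^ 2 / 8) * ((t - s) * ((2 : ℝ) ^ k) ^ 2))) :=
        ENNReal.tsum_le_tsum fun k => eLpNormDistrib_lpBlock_duhamel_le 𝒜 hK hu ht₁ ht₁t htT hB k
    _ = 3 * (K * ENNReal.ofReal M ^ 2) * ∑' k : ℤ, ∫⁻ s in Ioo t₁ t,
          ENNReal.ofReal ((2 : ℝ) ^ k * Real.exp (-(π ^ 2 / 8) * ((t - s) * ((2 : ℝ) ^ k) ^ 2))) := by
        rw [← ENNReal.tsum_mul_left]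
        refine tsum_congr fun k => ?_
        rw [lintegral_const_mul' _ _ hcfin]
        ring
    _ ≤ 3 * (K * ENNReal.ofReal M ^ 2) * (Kd * ENNReal.ofReal (Real.sqrt (t - t₁))) :=
        mul_le_mul' le_rfl (hKd t₁ t ht₁t)
    _ = 3 * K * Kd * ENNReal.ofReal (M ^ 2 * Real.sqrt (t - t₁)) := by
        rw [ENNReal.ofReal_mul (sq_nonneg M), ENNReal.ofReal_pow hM]
        ring

/-! ### The Besov–Duhamel bound -/

/-- **The Besov–Duhamel a-priori bound** (the mathematics of `stub_besovDuhamelBound`): for every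
averaging datum `𝒜` there is `C ≥ 1` such that every mild `H¹⁰_df` solution `u` on `[0,T)` obeys, for
`0 ≤ t₁ ≤ t < T`, `0 ≤ M` and `‖u(s)‖_{Ḃ⁰_{∞,1}} ≤ M` on `[t₁, t]`,
`‖u(t)‖_{Ḃ⁰_{∞,1}} ≤ C ‖u(t₁)‖_{Ḃ⁰_{∞,1}} + C √(t-t₁) M²`. -/
theorem besovDuhamelBound (𝒜 : AveragingDatum) :
    ∃ C : ℝ, 1 ≤ C ∧ ∀ (a : L2C) (T : ℝ) (u : ℝ → L2C),
      IsMildSolutionFor 𝒜.form a (Ico 0 T) u → ∀ t₁ t M : ℝ, 0 ≤ t₁ → t₁ ≤ t → t < T → 0 ≤ M →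
      (∀ s ∈ Icc t₁ t, eHomBesovNorm 0 ⊤ 1 ((u s : L2C) :
        𝓢'(EuclideanSpace ℝ (Fin 3), EuclideanSpace ℂ (Fin 3))) ≤ ENNReal.ofReal M) →
      eHomBesovNorm 0 ⊤ 1 ((u t : L2C) : 𝓢'(EuclideanSpace ℝ (Fin 3), EuclideanSpace ℂ (Fin 3))) ≤
        ENNReal.ofReal C * eHomBesovNorm 0 ⊤ 1 ((u t₁ : L2C) :
          𝓢'(EuclideanSpace ℝ (Fin 3), EuclideanSpace ℂ (Fin 3))) +
          ENNReal.ofReal (C * Real.sqrt (t - t₁) * M ^ 2) := by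
  obtain ⟨CH, hCH⟩ := exists_eHomBesovNorm_coe_heat_le
  obtain ⟨K, hKfin, hK⟩ := exists_enorm_form_heat_test_le 𝒜
  obtain ⟨Kd, hKdfin, hKd⟩ := exists_dyadic_time_bound
  set KD : ℝ≥0∞ := 3 * K * Kd with hKD
  have hKDfin : KD ≠ ⊤ := ENNReal.mul_ne_top (ENNReal.mul_ne_top (by norm_num) hKfin) hKdfin
  set C : ℝ := max (max 1 (CH : ℝ)) KD.toReal with hC
  have hC1 : 1 ≤ C := (le_max_left _ _).trans (le_max_left _ _)
  have hC0 : 0 ≤ C := zero_le_one.trans hC1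
  have hCH' : (CH : ℝ≥0∞) ≤ ENNReal.ofReal C := by
    rw [← ENNReal.ofReal_coe_nnreal]
    exact ENNReal.ofReal_le_ofReal ((le_max_right _ _).trans (le_max_left _ _))
  have hKD' : KD ≤ ENNReal.ofReal C := by
    rw [← ENNReal.ofReal_toReal hKDfin]
    exact ENNReal.ofReal_le_ofReal (le_max_right _ _)
  refine ⟨C, hC1, fun a T u hu t₁ t M ht₁ ht₁t htT hM hB => ?_⟩
  have hσ : 0 ≤ t - t₁ := sub_nonneg.2 ht₁t
  -- `u(t) = e^{(t-t₁)Δ}u(t₁) + D`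
  have hsplit : ((u t : L2C) : 𝓢'(EuclideanSpace ℝ (Fin 3), EuclideanSpace ℂ (Fin 3))) =
      ((heat (t - t₁) (u t₁) : L2C) : 𝓢'(EuclideanSpace ℝ (Fin 3), EuclideanSpace ℂ (Fin 3))) +
        ((u t - heat (t - t₁) (u t₁) : L2C) : 𝓢'(EuclideanSpace ℝ (Fin 3), EuclideanSpace ℂ (Fin 3))) := by
    rw [← Lp.toTemperedDistributionCLM_apply, ← Lp.toTemperedDistributionCLM_apply,
      ← Lp.toTemperedDistributionCLM_apply, ← map_add, add_sub_cancel]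
  have hD := eHomBesovNorm_duhamel_le 𝒜 hKfin hK hKd hu ht₁ ht₁t htT hM hB
  calc eHomBesovNorm 0 ⊤ 1 ((u t : L2C) : 𝓢'(EuclideanSpace ℝ (Fin 3), EuclideanSpace ℂ (Fin 3)))
      ≤ eHomBesovNorm 0 ⊤ 1 ((heat (t - t₁) (u t₁) : L2C) :
            𝓢'(EuclideanSpace ℝ (Fin 3), EuclideanSpace ℂ (Fin 3))) +
          eHomBesovNorm 0 ⊤ 1 ((u t - heat (t - t₁) (u t₁) : L2C) :
            𝓢'(EuclideanSpace ℝ (Fin 3), EuclideanSpace ℂ (Fin 3))) := by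
        rw [hsplit]
        exact eHomBesovNorm_add_le 0 ⊤ le_rfl _ _
    _ ≤ CH * eHomBesovNorm 0 ⊤ 1 ((u t₁ : L2C) : 𝓢'(EuclideanSpace ℝ (Fin 3), EuclideanSpace ℂ (Fin 3))) +
          KD * ENNReal.ofReal (M ^ 2 * Real.sqrt (t - t₁)) :=
        add_le_add (hCH _ hσ _) (by rw [hKD]; exact hD)
    _ ≤ ENNReal.ofReal C * eHomBesovNorm 0 ⊤ 1 ((u t₁ : L2C) :
            𝓢'(EuclideanSpace ℝ (Fin 3), EuclideanSpace ℂ (Fin 3))) +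
          ENNReal.ofReal C * ENNReal.ofReal (M ^ 2 * Real.sqrt (t - t₁)) := by
        gcongr
    _ = ENNReal.ofReal C * eHomBesovNorm 0 ⊤ 1 ((u t₁ : L2C) :
            𝓢'(EuclideanSpace ℝ (Fin 3), EuclideanSpace ℂ (Fin 3))) +
          ENNReal.ofReal (C * Real.sqrt (t - t₁) * M ^ 2) := by
        rw [← ENNReal.ofReal_mul hC0]
        congr 2
        ring

end Summit.NavierStokesRegularity.NavierStokesRegularity.Theorems.PerpetualPumpThesis.FA

namespace Summit.NavierStokesRegularity.NavierStokesRegularity.Theorems.PerpetualPumpThesis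

open MeasureTheory Set Filter Topology
open scoped ENNReal SchwartzMap
open Literature.Analysis.FluidPDE Literature.Analysis.FluidPDE.Tao2016
open Literature.Analysis.FunctionSpaces

/-- Local notation for physical / frequency space `ℝ³` (as printed by the registered signature). -/
local notation "ℝ³" => EuclideanSpace ℝ (Fin 3)
/-- Local notation for the complexified range `ℂ³` (as printed by the registered signature). -/
local notation "ℂ³" => EuclideanSpace ℂ (Fin 3)

/-- **Stub `besovDuhamelBound` (tag FA) of line `SketchIdeator2` for `PerpetualPump.Thesis`**: the
Besov–Duhamel a-priori bound in `Ḃ⁰_{∞,1}` along `H¹⁰_df`-mild solutions of the averaged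
Navier–Stokes equation of an ARBITRARY averaging datum `𝒜` (Tao 2016, (1.12)–(1.15)): there is
`C ≥ 1` such that for every mild solution `u` on `[0,T)`, all `0 ≤ t₁ ≤ t < T`, `M ≥ 0` with
`‖u(s)‖_{Ḃ⁰_{∞,1}} ≤ M` on `[t₁,t]`,
`‖u(t)‖_{Ḃ⁰_{∞,1}} ≤ C ‖u(t₁)‖_{Ḃ⁰_{∞,1}} + C √(t-t₁) M²` (heat bounded on `Ḃ⁰_{∞,1}`; the key
bilinear estimate `‖e^{σΔ}B̃(f,f)‖_{Ḃ⁰_{∞,1}} ≲ σ^{-1/2}‖f‖²_{Ḃ⁰_{∞,1}}` blockwise, with no `σ⁰`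
term, so the constant is `T`-independent). -/
theorem stub_besovDuhamelBound : ∀ 𝒜 : AveragingDatum, ∃ C : ℝ, 1 ≤ C ∧ ∀ (a : L2C) (T : ℝ) (u : ℝ → L2C), IsMildSolutionFor 𝒜.form a (Ico 0 T) u → ∀ t₁ t M : ℝ, 0 ≤ t₁ → t₁ ≤ t → t < T → 0 ≤ M → (∀ s ∈ Icc t₁ t, eHomBesovNorm 0 ⊤ 1 ((u s : L2C) : 𝓢'(ℝ³, ℂ³)) ≤ ENNReal.ofReal M) → eHomBesovNorm 0 ⊤ 1 ((u t : L2C) : 𝓢'(ℝ³, ℂ³)) ≤ ENNReal.ofReal C * eHomBesovNorm 0 ⊤ 1 ((u t₁ : L2C) : 𝓢'(ℝ³, ℂ³)) + ENNReal.ofReal (C * Real.sqrt (t - t₁) * M ^ 2) :=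
  fun 𝒜 => FA.besovDuhamelBound 𝒜

end Summit.NavierStokesRegularity.NavierStokesRegularity.Theorems.PerpetualPumpThesis
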